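import Literature.AnabelianGeometry.EtaleTheta.Discharge.Sec2Cor219iiiPullback
import HarnessLib

/-!
# [EtTh] Cor. 2.19 (iii), tower form (`ThetaEnvTower.Cor219_iii`, F-0650) — part 2c (GENERIC): the level-wise ASSEMBLY
# «heart ⇒ pulled-back collection ⊆ collection · (c ∘ aug)» (roadmap G8, ⊆ half; proof-only)

S. Mochizuki, *The étale theta function and its Frobenioid-theoretic manifestations*, Publ. RIMS **45** (2009)
[EtTh], §2, Cor. 2.19 (iii), PRIMS PDF p. 65; Def. 2.13 p. 47 ("conjugation by an element of `μ_N` corresponds precisely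
to modifying a cocycle by a coboundary"; "replacing `η̲̈^{Θ,l·ℤ×μ₂}` by an `O^×_K`-multiple … an `O^×_K`-conjugate")
[cite: MochizukiEtTh2009, Cor 2.19(iii) p.65].

Cell `abc-iut`, seat abc-iut-w4-d038 (gen 9), K-L6 / C-R33 row «COR219III-AT-MODELTATE», PART 2c — roadmap G8 (⊆ half)
(HOME/staging/L6/w4-d038/g9/COR219III-PART2-ROADMAP.md), GENERIC over every §1 setting.  PROOF-ONLY: no definition, no
instance, no notation, no new named fact; sequel of this seat's `Sec2Cor219iiiInnerAut` / `Sec2Cor219iiiTransport` /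
`Sec2Cor219iiiPullback`; abc-iut-L2-t8's `rootCocycles_rel` / `cobAt` / `conjRoot` and abc-iut-L2-t2's
`ThetaEnvTower.conjCocycle` / `pullbackCocycle` consumed BY NAME.

WHAT IS SHOWN (`T := C.thetaEnvTower τ hC hS`, level `M`, `γ` with clauses `γ(Π^tp_Ÿ̲̲) = Π^tp_Ÿ̲̲`, `γ(θ⁻¹(l·Δ_Θ)) = θ⁻¹(l·Δ_Θ)`,
`γ̃` induced on `l·Δ_Θ`, `γ̄_M` admitted):
* `conjCocycle_conjCocycle` — `Inn(y) ∘ Inn(x) = Inn(yx)` on mod-`M` cocycles; `coboundary_inv`; `envCocycle_conj` — the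
  crossed-homomorphism identity `χ(u)·c(u⁻¹ s u) = c(s) · (∂_{μ_M} c(u))(s)⁻¹` for a `G_K`-cocycle `c`;
* **`pullback_image_subset_of_heart`** — IF (HEART) the transport of ONE root cocycle `f₀` reduces mod `M` to
  `Inn(x)(red_M ∘ f₀) · (c ∘ aug)` for some `x ∈ Π^tp_X̲̲` and a `G_K`-cocycle `c`, and (HCOB) `γ̃⁻¹` carries `l·Δ_Θ`-valued
  coboundaries of `Δ_Θ` on `Π^tp_Ÿ̲̲` to coboundaries (true when `γ̃` extends to `Δ_Θ ≅ Ẑ`, e.g. at the models of record),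
  THEN the pulled-back mod-`M` collection is CONTAINED in the collection multiplied by `c ∘ aug` — the ⊆ half of the
  level-`M` clause of `ThetaEnvTower.Cor219_iii` (every root cocycle is `conjRoot τ f₀ · ∂d`, abc-iut-L2-t8
  `rootCocycles_rel`; transport those two factors by `transport_conj` / HCOB; absorb by PART 1's conjugation stability and
  `mul_coboundary_mem`).

HONEST FRAMING: unconditional statements about OUR typed objects over an arbitrary §1 setting; nothing of [EtTh] (refereed)
is asserted beyond what is proved; no side is taken on [IUTchIII] Cor. 3.12; typed ≠ proved; nothing asserts abc proved or
refuted.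
-/

noncomputable section

namespace Literature.AnabelianGeometry.EtaleTheta

open Literature.AnabelianGeometry.SemiGraphs
open scoped IsMulCommutative

namespace ThetaSetting.EtaleThetaData.DoubleUnderline

variable {p : ℕ} [Fact p.Prime] {D : ThetaSetting p} {E : D.EtaleThetaData} {l : ℕ}
  (C : E.DoubleUnderline l) {Es : Set ℕ+} (τ : D.CyclotomeTower l Es)

/-! ## §1. Bookkeeping on mod-`M` cocycles -/

/-- `Inn(y) ∘ Inn(x) = Inn(y·x)` on mod-`M` cocycles of the §1-instantiated tower (pointwise).
[cite: MochizukiEtTh2009, Cor 2.16 p.54] -/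
theorem conjCocycle_conjCocycle (hC : D.Compat) (hS : D.Sec2Hyps) (M : Es)
    (x y : (C.thetaEnvTower τ hC hS).PiX)
    (η : (C.thetaEnvTower τ hC hS).PiYdd → (C.thetaEnvTower τ hC hS).mu M) :
    (C.thetaEnvTower τ hC hS).conjCocycle M y ((C.thetaEnvTower τ hC hS).conjCocycle M x η) =
      (C.thetaEnvTower τ hC hS).conjCocycle M (y * x) η := by
  funext g
  change (C.thetaEnvTower τ hC hS).chi M ((C.thetaEnvTower τ hC hS).aug y)
      ((C.thetaEnvTower τ hC hS).chi M ((C.thetaEnvTower τ hC hS).aug x) (η ⟨x⁻¹ * _ * x, _⟩)) =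
    (C.thetaEnvTower τ hC hS).chi M ((C.thetaEnvTower τ hC hS).aug (y * x)) (η ⟨(y * x)⁻¹ * _ * (y * x), _⟩)
  rw [← MulAut.mul_apply, ← map_mul, ← map_mul]
  congr 2
  apply Subtype.ext
  change x⁻¹ * (y⁻¹ * (g : (C.thetaEnvTower τ hC hS).PiX) * y) * x = (y * x)⁻¹ * g * (y * x)
  group

/-- The inverse of a `μ_M`-coboundary is the coboundary of the inverse element.
[cite: MochizukiEtTh2009, Def 2.13 p.47] -/
theorem coboundary_inv {P G μ : Type*} [Group P] [Group G] [CommGroup μ] (aug : P →* G) (χ : G →* MulAut μ)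
    (c : μ) (g : P) :
    (CycEnvelope.coboundary aug χ c g)⁻¹ = CycEnvelope.coboundary aug χ c⁻¹ g := by
  simp only [CycEnvelope.coboundary, map_inv, mul_inv, inv_inv]

/-- **The crossed-homomorphism identity** for a `G`-cocycle `c` (`c(ab) = c(a)·χ(a)c(b)`):
`χ(u) · c(u⁻¹ s u) = c(s) · (χ(s) c(u)) · c(u)⁻¹`, i.e. conjugating the argument changes `c` by the coboundary of `c(u)`.
[cite: MochizukiEtTh2009, Def 2.13 p.47] -/
theorem envCocycle_conj {G μ : Type*} [Group G] [CommGroup μ] (χ : G →* MulAut μ) (c : G → μ)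
    (hc : CycEnvelope.IsEnvCocycle (MonoidHom.id G) χ c) (u s : G) :
    χ u (c (u⁻¹ * s * u)) = c s * (χ s (c u) * (c u)⁻¹) := by
  have hc' : ∀ a b : G, c (a * b) = c a * χ a (c b) := fun a b => by
    have h := hc a b
    rwa [MonoidHom.id_apply] at h
  have h1 : c 1 = 1 := by
    have h := hc' 1 1
    rw [mul_one, map_one, MulAut.one_apply] at h
    have h' : c 1 * c 1 = c 1 * 1 := by rw [mul_one]; exact h.symm
    exact mul_left_cancel h'
  have h2 : χ u (c u⁻¹) = (c u)⁻¹ := by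
    have h := hc' u u⁻¹
    rw [mul_inv_cancel, h1] at h
    exact eq_inv_of_mul_eq_one_right h.symm
  have e2 : χ u (χ u⁻¹ (c s)) = c s := by
    rw [← MulAut.mul_apply, ← map_mul, mul_inv_cancel, map_one, MulAut.one_apply]
  have e3 : χ u (χ (u⁻¹ * s) (c u)) = χ s (c u) := by
    rw [← MulAut.mul_apply, ← map_mul, ← mul_assoc, mul_inv_cancel, one_mul]
  calc χ u (c (u⁻¹ * s * u))
      = χ u (c u⁻¹ * χ u⁻¹ (c s) * χ (u⁻¹ * s) (c u)) := by rw [hc' (u⁻¹ * s) u, hc' u⁻¹ s]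
    _ = χ u (c u⁻¹) * χ u (χ u⁻¹ (c s)) * χ u (χ (u⁻¹ * s) (c u)) := by rw [map_mul (χ u), map_mul (χ u)]
    _ = (c u)⁻¹ * c s * χ s (c u) := by rw [h2, e2, e3]
    _ = c s * (χ s (c u) * (c u)⁻¹) := by rw [mul_assoc, mul_comm, mul_assoc]

/-! ## §2. The level-wise assembly (⊆ half) -/

/-- The product of a root cocycle with an `l·Δ_Θ`-valued coboundary of `Δ_Θ` is a root cocycle (same class).
[cite: MochizukiEtTh2009, Def 2.13 p.47] -/
theorem rootCocycle_mul_cobAt_mem (hC : D.Compat) (f : contCocycles D.toTheta D.DeltaTheta C.GtpYdduu)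
    (hf : f ∈ C.rootCocycles hC) (d : D.DeltaTheta)
    (hd : ∀ k : C.GtpYdduu, (cobAt d (D.toTheta (k : D.PiTemp)) : D.GtpTheta) ∈ D.lDeltaTheta l) :
    f * ⟨fun k : C.GtpYdduu => cobAt d (D.toTheta (k : D.PiTemp)), coboundary_mem_contCocycles (D := D) d C.GtpYdduu⟩ ∈
      C.rootCocycles hC := by
  refine ⟨fun k => ?_, ?_⟩
  · change ((f.1 k * cobAt d (D.toTheta (k : D.PiTemp)) : D.DeltaTheta) : D.GtpTheta) ∈ D.lDeltaTheta l
    rw [Subgroup.coe_mul]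
    exact mul_mem (hf.1 k) (hd k)
  · obtain ⟨σ, hσ, hclass⟩ := hf.2
    refine ⟨σ, hσ, ?_⟩
    rw [← hclass]
    change (QuotientGroup.mk (f * _) : D.H1 C.GtpYdduu) = QuotientGroup.mk f
    rw [QuotientGroup.eq, Subgroup.mem_subgroupOf, mem_contCoboundaries_iff]
    refine ⟨d⁻¹, funext fun k => ?_⟩
    change (f.1 k * cobAt d (D.toTheta (k : D.PiTemp)))⁻¹ * f.1 k = _
    rw [mul_inv_rev, inv_mul_cancel_right, cobAt, mul_inv_rev, inv_inv, map_inv]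
    exact mul_comm _ _

/-- **G8 (⊆ half): the level-wise assembly from the heart.** Let `γ` be a bi-continuous automorphism of `Π^tp_X̲̲` with
`γ(Π^tp_Ÿ̲̲) = Π^tp_Ÿ̲̲`, `γ(θ⁻¹(l·Δ_Θ)) = θ⁻¹(l·Δ_Θ)`, `γ̃` induced on `l·Δ_Θ` (`exists_lDeltaAut`), `γ̄_M` admitted.  Suppose
(HEART) for ONE root cocycle `f₀` the transport reduces mod `M` to `Inn(x)(red_M ∘ f₀) · (c ∘ aug)` with `x ∈ Π^tp_X̲̲` and a
`G_K`-cocycle `c`, and (HCOB) `γ̃⁻¹` carries the `l·Δ_Θ`-valued coboundaries of `Δ_Θ` along `γ` to coboundaries.  THEN the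
pulled-back mod-`M` theta collection is CONTAINED in the collection multiplied by `c ∘ aug`.
[cite: MochizukiEtTh2009, Cor 2.19(iii) p.65] -/
theorem pullback_image_subset_of_heart (hC : D.Compat) (hS : D.Sec2Hyps) (M : Es)
    (γ : (C.thetaEnvTower τ hC hS).PiX ≃ₜ* (C.thetaEnvTower τ hC hS).PiX)
    (hγ : (C.thetaEnvTower τ hC hS).PiYdd.map γ.toMulEquiv.toMonoidHom = (C.thetaEnvTower τ hC hS).PiYdd)
    (hL : (C.thetaEnvTower τ hC hS).lDeltaTheta.map γ.toMulEquiv.toMonoidHom = (C.thetaEnvTower τ hC hS).lDeltaTheta)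
    (γΛ : D.lDeltaTheta l ≃* D.lDeltaTheta l)
    (hγΛ : ∀ (g : (C.thetaEnvTower τ hC hS).lDeltaTheta) (hg : γ g ∈ (C.thetaEnvTower τ hC hS).lDeltaTheta),
      C.toLDelta ⟨γ g, hg⟩ = γΛ (C.toLDelta g))
    (γμ : (C.thetaEnvTower τ hC hS).mu M ≃* (C.thetaEnvTower τ hC hS).mu M)
    (hcompat : ∀ (g : (C.thetaEnvTower τ hC hS).lDeltaTheta) (hg : γ g ∈ (C.thetaEnvTower τ hC hS).lDeltaTheta),
      (C.thetaEnvTower τ hC hS).thetaMod M ⟨γ g, hg⟩ = γμ ((C.thetaEnvTower τ hC hS).thetaMod M g))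
    (f₀ : contCocycles D.toTheta D.DeltaTheta C.GtpYdduu) (hf₀ : f₀ ∈ C.rootCocycles hC)
    (x : (C.thetaEnvTower τ hC hS).PiX) (c : (C.thetaEnvTower τ hC hS).G → (C.thetaEnvTower τ hC hS).mu M)
    (hc : CycEnvelope.IsEnvCocycle (MonoidHom.id (C.thetaEnvTower τ hC hS).G) ((C.thetaEnvTower τ hC hS).chi M) c)
    (heart : ∀ g : (C.thetaEnvTower τ hC hS).PiYdd,
      (τ.mod M).red (γΛ.symm ⟨(f₀.1 (C.inclYdduu ⟨γ g, C.apply_mem_PiYdd τ hC hS γ hγ g⟩) : D.GtpTheta), hf₀.1 _⟩) =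
        (C.thetaEnvTower τ hC hS).conjCocycle M x (C.modN (τ.mod M) f₀ hf₀.1) g *
          c ((C.thetaEnvTower τ hC hS).aug (g : (C.thetaEnvTower τ hC hS).PiX)))
    (hcob : ∀ d : D.DeltaTheta,
      (∀ k : C.GtpYdduu, (cobAt d (D.toTheta (k : D.PiTemp)) : D.GtpTheta) ∈ D.lDeltaTheta l) →
      ∃ d' : D.DeltaTheta, ∀ (g : (C.thetaEnvTower τ hC hS).PiYdd)
        (hmem : (cobAt d (D.toTheta ((C.inclYdduu ⟨γ g, C.apply_mem_PiYdd τ hC hS γ hγ g⟩ : C.GtpYdduu) :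
          D.PiTemp)) : D.GtpTheta) ∈ D.lDeltaTheta l),
        (γΛ.symm ⟨_, hmem⟩ : D.GtpTheta) = (cobAt d' (D.toTheta ((C.inclYdduu g : C.GtpYdduu) : D.PiTemp)) : D.GtpTheta)) :
    (C.thetaEnvTower τ hC hS).pullbackCocycle M γ hγ γμ '' (C.thetaEnvTower τ hC hS).thetaCocycles M ⊆
      (fun η => η * (c ∘ (C.thetaEnvTower τ hC hS).aug ∘ (C.thetaEnvTower τ hC hS).PiYdd.subtype)) ''
        (C.thetaEnvTower τ hC hS).thetaCocycles M := by
  rintro _ ⟨η, hη, rfl⟩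
  obtain ⟨f, hf, rfl⟩ := hη
  -- `f = conjRoot σ f₀ · ∂d`
  obtain ⟨σ, d, hrel⟩ := C.rootCocycles_rel hC hf₀ hf
  have hdΛ : ∀ k : C.GtpYdduu, (cobAt d (D.toTheta (k : D.PiTemp)) : D.GtpTheta) ∈ D.lDeltaTheta l :=
    fun k => cobAt_mem hC hf₀ hf hrel k
  obtain ⟨d', hd'⟩ := hcob d hdΛ
  -- the conjugate `f₁ = conjRoot σ f₀` as a root cocycle, and the transports of `f₀`, `f₁`, `f`
  obtain ⟨f₁, hf₁, hf₁val⟩ := C.exists_rootCocycle_conj hC σ f₀ hf₀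
  obtain ⟨F₀, hF₀a, -, -⟩ := C.exists_transport τ hC hS γ hγ hL γΛ hγΛ f₀ hf₀.1
  obtain ⟨F₁, hF₁a, -, -⟩ := C.exists_transport τ hC hS γ hγ hL γΛ hγΛ f₁ hf₁.1
  obtain ⟨F, hFa, -, hFred⟩ := C.exists_transport τ hC hS γ hγ hL γΛ hγΛ f hf.1
  rw [hFred M γμ hcompat]
  -- abbreviations: `y := γ⁻¹ σ`
  have hyx_mem : ∀ g : (C.thetaEnvTower τ hC hS).PiYdd,
      (γ.symm σ)⁻¹ * (g : (C.thetaEnvTower τ hC hS).PiX) * γ.symm σ ∈ (C.thetaEnvTower τ hC hS).PiYdd := fun g => by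
    simpa [mul_assoc] using (C.thetaEnvTower τ hC hS).PiYdd_normal.conj_mem _ g.2 (γ.symm σ)⁻¹
  -- the new root cocycle `f₂ = conjRoot (y·x) f₀ · ∂d'`
  obtain ⟨f₁', hf₁', hf₁'val⟩ := C.exists_rootCocycle_conj hC (γ.symm σ * x) f₀ hf₀
  have hd'Λ : ∀ k : C.GtpYdduu, (cobAt d' (D.toTheta (k : D.PiTemp)) : D.GtpTheta) ∈ D.lDeltaTheta l := by
    intro k
    have hk : C.inclYdduu ⟨⟨(k : D.PiTemp), (Subgroup.mem_inf.1 k.2).2⟩, (Subgroup.mem_inf.1 k.2).1⟩ = k := rfl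
    rw [← hk, ← hd' _ (hdΛ _)]
    exact (γΛ.symm _).2
  have hf₂ := C.rootCocycle_mul_cobAt_mem hC f₁' hf₁' d' hd'Λ
  -- the witness
  refine ⟨C.modN (τ.mod M) _ hf₂.1 *
      CycEnvelope.coboundary ((C.thetaEnvTower τ hC hS).aug.comp (C.thetaEnvTower τ hC hS).PiYdd.subtype)
        ((C.thetaEnvTower τ hC hS).chi M) (c ((C.thetaEnvTower τ hC hS).aug (γ.symm σ)))⁻¹,
    (C.thetaEnvTower τ hC hS).mul_coboundary_mem M _ ⟨_, hf₂, rfl⟩ _, ?_⟩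
  funext g
  -- LEFT: reduce `F (incl g)` to `F₁ (incl g) · ∂d'(g)`
  have hsplit : F (C.inclYdduu g) =
      F₁ (C.inclYdduu g) * ⟨cobAt d' (D.toTheta ((C.inclYdduu g : C.GtpYdduu) : D.PiTemp)), hd'Λ _⟩ := by
    rw [hFa, hF₁a]
    have hprod : (⟨(f.1 (C.inclYdduu ⟨γ g, C.apply_mem_PiYdd τ hC hS γ hγ g⟩) : D.GtpTheta), hf.1 _⟩ : D.lDeltaTheta l) =
        ⟨(f₁.1 (C.inclYdduu ⟨γ g, C.apply_mem_PiYdd τ hC hS γ hγ g⟩) : D.GtpTheta), hf₁.1 _⟩ *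
          ⟨_, hdΛ (C.inclYdduu ⟨γ g, C.apply_mem_PiYdd τ hC hS γ hγ g⟩)⟩ := by
      apply Subtype.ext
      change ((f.1 (C.inclYdduu ⟨γ g, C.apply_mem_PiYdd τ hC hS γ hγ g⟩) : D.DeltaTheta) : D.GtpTheta) =
        ((f₁.1 (C.inclYdduu ⟨γ g, C.apply_mem_PiYdd τ hC hS γ hγ g⟩) : D.DeltaTheta) : D.GtpTheta) *
          (cobAt d (D.toTheta ((C.inclYdduu ⟨γ g, C.apply_mem_PiYdd τ hC hS γ hγ g⟩ : C.GtpYdduu) : D.PiTemp)) :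
            D.GtpTheta)
      rw [hrel, hf₁val, Subgroup.coe_mul]
      rfl
    rw [hprod, map_mul]
    congr 1
    apply Subtype.ext
    exact hd' g (hdΛ _)
  -- LEFT: `red (F₁ (incl g)) = χ(aug y) · red (F₀ (incl (y⁻¹ g y)))`
  have hF₁red : (τ.mod M).red (F₁ (C.inclYdduu g)) =
      galMuN p M (D.aug.toMonoidHom ((γ.symm σ : (C.thetaEnvTower τ hC hS).PiX) : D.PiTemp))
        ((τ.mod M).red (F₀ (C.inclYdduu ⟨_, hyx_mem g⟩))) := by
    rw [← (τ.mod M).red_conj]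
    congr 1
    apply Subtype.ext
    exact C.transport_conj τ hC hS γ hγ hL γΛ hγΛ f₀ f₁ hf₀.1 hf₁.1 σ hf₁val F₀ F₁ hF₀a hF₁a g (hyx_mem g)
  -- the heart at `y⁻¹ g y`
  have hheart := heart ⟨_, hyx_mem g⟩
  rw [hF₀a] at hF₁red
  -- RIGHT: `modN f₂ g = Inn(y x)(modN f₀) g · red ∂d'(g)`
  have hf₂val : C.modN (τ.mod M) _ hf₂.1 g =
      (C.thetaEnvTower τ hC hS).conjCocycle M (γ.symm σ * x) (C.modN (τ.mod M) f₀ hf₀.1) g *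
        (τ.mod M).red ⟨cobAt d' (D.toTheta ((C.inclYdduu g : C.GtpYdduu) : D.PiTemp)), hd'Λ _⟩ := by
    change (τ.mod M).red ⟨((f₁'.1 (C.inclYdduu g) * cobAt d' (D.toTheta ((C.inclYdduu g : C.GtpYdduu) : D.PiTemp)) :
        D.DeltaTheta) : D.GtpTheta), _⟩ = _
    have hmul : (⟨((f₁'.1 (C.inclYdduu g) * cobAt d' (D.toTheta ((C.inclYdduu g : C.GtpYdduu) : D.PiTemp)) :
        D.DeltaTheta) : D.GtpTheta), hf₂.1 (C.inclYdduu g)⟩ : D.lDeltaTheta l) =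
        ⟨(f₁'.1 (C.inclYdduu g) : D.GtpTheta), hf₁'.1 _⟩ *
          ⟨cobAt d' (D.toTheta ((C.inclYdduu g : C.GtpYdduu) : D.PiTemp)), hd'Λ _⟩ :=
      Subtype.ext (by rw [Subgroup.coe_mul, Subgroup.coe_mul])
    rw [hmul, map_mul]
    congr 1
    -- `red (f₁' (g)) = χ(aug (yx)) · red (f₀ ((yx)⁻¹ g (yx)))`
    have hmem2 : (γ.symm σ * x)⁻¹ * (g : (C.thetaEnvTower τ hC hS).PiX) * (γ.symm σ * x) ∈
        (C.thetaEnvTower τ hC hS).PiYdd := by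
      simpa [mul_assoc] using (C.thetaEnvTower τ hC hS).PiYdd_normal.conj_mem _ g.2 (γ.symm σ * x)⁻¹
    change _ = galMuN p M (D.aug.toMonoidHom (((γ.symm σ * x : (C.thetaEnvTower τ hC hS).PiX)) : D.PiTemp))
      ((τ.mod M).red ⟨(f₀.1 (C.inclYdduu ⟨_, hmem2⟩) : D.GtpTheta), hf₀.1 _⟩)
    rw [← (τ.mod M).red_conj]
    congr 1
    apply Subtype.ext
    change ((f₁'.1 (C.inclYdduu g) : D.DeltaTheta) : D.GtpTheta) = _
    rw [hf₁'val, MulAut.conjNormal_apply]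
    rfl
  -- assemble: bookkeeping identities first
  have hconj : (C.thetaEnvTower τ hC hS).conjCocycle M (γ.symm σ)
      ((C.thetaEnvTower τ hC hS).conjCocycle M x (C.modN (τ.mod M) f₀ hf₀.1)) g =
      galMuN p M (D.aug.toMonoidHom ((γ.symm σ : (C.thetaEnvTower τ hC hS).PiX) : D.PiTemp))
        ((C.thetaEnvTower τ hC hS).conjCocycle M x (C.modN (τ.mod M) f₀ hf₀.1) ⟨_, hyx_mem g⟩) := rfl
  -- `aug (y⁻¹ g y) = (aug y)⁻¹ · aug g · aug y`
  have haug : (C.thetaEnvTower τ hC hS).aug ((⟨_, hyx_mem g⟩ : (C.thetaEnvTower τ hC hS).PiYdd) :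
      (C.thetaEnvTower τ hC hS).PiX) =
      ((C.thetaEnvTower τ hC hS).aug (γ.symm σ))⁻¹ *
        ((C.thetaEnvTower τ hC hS).aug (g : (C.thetaEnvTower τ hC hS).PiX) * (C.thetaEnvTower τ hC hS).aug (γ.symm σ)) := by
    apply eq_inv_mul_of_mul_eq
    rw [← map_mul, ← map_mul]
    congr 1
    change γ.symm σ * ((γ.symm σ)⁻¹ * (g : (C.thetaEnvTower τ hC hS).PiX) * γ.symm σ) = _
    group
  -- the `c`-bookkeeping: `χ(aug y) · c(aug(y⁻¹ g y)) = c(aug g) · (∂ c(aug y))(g)⁻¹`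
  have hcc : galMuN p M (D.aug.toMonoidHom ((γ.symm σ : (C.thetaEnvTower τ hC hS).PiX) : D.PiTemp))
      (c ((C.thetaEnvTower τ hC hS).aug ((⟨_, hyx_mem g⟩ : (C.thetaEnvTower τ hC hS).PiYdd) :
        (C.thetaEnvTower τ hC hS).PiX))) =
      c ((C.thetaEnvTower τ hC hS).aug (g : (C.thetaEnvTower τ hC hS).PiX)) *
        (CycEnvelope.coboundary ((C.thetaEnvTower τ hC hS).aug.comp (C.thetaEnvTower τ hC hS).PiYdd.subtype)
          ((C.thetaEnvTower τ hC hS).chi M) (c ((C.thetaEnvTower τ hC hS).aug (γ.symm σ))) g)⁻¹ := by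
    rw [haug, ← mul_assoc]
    have h := envCocycle_conj ((C.thetaEnvTower τ hC hS).chi M) c hc ((C.thetaEnvTower τ hC hS).aug (γ.symm σ))
      ((C.thetaEnvTower τ hC hS).aug (g : (C.thetaEnvTower τ hC hS).PiX))
    change (C.thetaEnvTower τ hC hS).chi M ((C.thetaEnvTower τ hC hS).aug (γ.symm σ)) _ = _ at h ⊢
    rw [h]
    rfl
  -- assemble
  simp only [Pi.mul_apply, Function.comp_apply]
  symm
  rw [hsplit, map_mul, hF₁red, hheart, map_mul, hf₂val, ← C.conjCocycle_conjCocycle τ hC hS M x (γ.symm σ), hconj,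
    hcc, coboundary_inv]
  ac_rfl

end ThetaSetting.EtaleThetaData.DoubleUnderline

end Literature.AnabelianGeometry.EtaleTheta

end
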